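import Summits.Ventures.PercRepro.C025ProfilePLDUniformTable_r11_s2_m4A
import Summits.Ventures.PercRepro.C025ProfilePLDUniformTable_r11_s2_m4B
import Summits.Ventures.PercRepro.C025ProfilePLDUniformTable_r11_s2_m4C
import Summits.Ventures.PercRepro.C025ProfilePLDUniformTable_r11_s2_m4D
import Summits.Ventures.PercRepro.C025ProfilePLDUniformTable_r11_s2_m4E
import Summits.Ventures.PercRepro.C025ProfilePLDUniformTable_r11_s2_m4F
import Summits.Ventures.PercRepro.C025ProfilePLDUniformTable_r11_s2_m4G
import Summits.Ventures.PercRepro.C025ProfilePLDUniformTable_r11_s2_m4H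
import Summits.Ventures.PercRepro.C025ProfilePLDUniformTable_r11_s2_m4I
import Summits.Ventures.PercRepro.C025ProfilePLDUniformTable_r11_s2_m4J
import Summits.Ventures.PercRepro.C025ProfilePLDUniformTable_r11_s2_m4K
import Summits.Ventures.PercRepro.C025ProfilePLDUniformTable_r11_s2_m4L
import Summits.Ventures.PercRepro.C025ProfilePLDUniformTable_r11_s2_m4M
import Summits.Ventures.PercRepro.C025ProfilePLDUniformTable_r11_s2_m4N
import Summits.Ventures.PercRepro.C025ProfilePLDUniformTwoLiftArith

/-!
# (PLD) FOR «M ⊕ U_{2,m}» FOR EVERY m ≥ 4 AND EVERY (PLD)-MATROID M OF RANK ≤ 11: THE CERTIFICATE TABLE FOR U_{2,4} LIFTED IN m (night-3 g35)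

`proofs/NIGHT3-G35-BASEMAP.md` §2 (the identity of g31, `proofs/NIGHT3-G31-TWOLIFT.md`).  The profile of the line `U_{2,m}` is `T₀₂ + m·T₁₂ + c_m·δ₂₂` with
`c_m = Σ_{2 ≤ i ≤ m−2} C(m,i)` (`PLDTwoLiftGen.sum_choose_min_two`, `m ≥ 3`), and both `T₁₂` (`coloop` after `shift11`) and
`δ₂₂` (`shift11` twice) preserve PER-LAYER DOMINANCE at the array level (g29).  Since `m ↦ m` and `m ↦ c_m` are
non-decreasing (`sum_choose_mid_mono`), every (PLD) instance of `M ⊕ U_{2,m}` is the same instance of `M ⊕ U_{2,m₀}` plus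
nonnegative multiples of preserved instances (`PLDTwoLiftGen.lift_instance`, `3 ≤ m₀ ≤ m`): ONE certificate table — the
landed `uniform_2_4_table_11` for `M ⊕ U_{2,4}` at rank ≤ 11 — gives (PLD) for `M ⊕ U_{2,m}` for EVERY `m ≥ 4`
(`pld_disjointSum_uniform_two_ge_4_of_eRank_le_11`).  THE CEILING OF BASE 4: rank 11 is the last rank at which `U_{2,4}` is certifiable (the base map of g35: `U_{2,4}` fails at rank 12, target (8,8,1) — `C025ProfilePLDLineFarkasTwelve`), so this is the last floor of the line tower with base 4.
  No `def`, no `instance`, no notation.  Axioms: standard.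
-/

open scoped Matroid

namespace PercRepro

open Finset ThmH

namespace PLDTwoLiftGen

variable {α : Type} [DecidableEq α]

/-- (PLD) FOR «M ⊕ U_{2,m}» FOR EVERY `m ≥ 4` AND EVERY (PLD)-MATROID `M` OF RANK ≤ 11: the uniform matroid is
`truncate (freeOn F) 2` with `|F| = m ≥ 4`. -/
theorem pld_disjointSum_uniform_two_ge_4_of_eRank_le_11 (M : Matroid α) [M.Finite] (hr : M.eRank ≤ 11)
    (hPLD : ∀ lo hi δ Θ : ℕ, Θ ≤ lo + hi + δ → (lo = 0 ∨ lo + hi + δ ≤ Θ) →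
      (∑ I ∈ (gr M).powerset, (if lo ≤ (M.eRk (I : Set α)).toNat ∧ (M.eRk (I : Set α)).toNat ≤ hi ∧
          Θ ≤ (M.eRk ((gr M \ I : Finset α) : Set α)).toNat + (M.eRk (I : Set α)).toNat then
          ((M.eRk ((gr M \ I : Finset α) : Set α)).toNat).choose δ else 0)) ≤
        ∑ I ∈ (gr M).powerset, (if lo + δ ≤ (M.eRk ((gr M \ I : Finset α) : Set α)).toNat ∧
          (M.eRk ((gr M \ I : Finset α) : Set α)).toNat ≤ hi + δ then
          ((M.eRk ((gr M \ I : Finset α) : Set α)).toNat).choose δ else 0))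
    (F : Finset α) (hF : 4 ≤ F.card)
    (h : Disjoint M.E (@Matroid.truncate α (Matroid.freeOn (F : Set α)) (PLDTruncate.freeOn_finite' F) 2).E) :
    haveI := PLDTruncate.freeOn_finite' F
    haveI := PLDClosure.disjointSum_finite' _ _ h
    ∀ lo hi δ Θ : ℕ, Θ ≤ lo + hi + δ → (lo = 0 ∨ lo + hi + δ ≤ Θ) →
      (∑ I ∈ (gr (M.disjointSum (Matroid.truncate (Matroid.freeOn (F : Set α)) 2) h)).powerset, (if lo ≤ ((M.disjointSum (Matroid.truncate (Matroid.freeOn (F : Set α)) 2) h).eRk (I : Set α)).toNat ∧ ((M.disjointSum (Matroid.truncate (Matroid.freeOn (F : Set α)) 2) h).eRk (I : Set α)).toNat ≤ hi ∧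
          Θ ≤ ((M.disjointSum (Matroid.truncate (Matroid.freeOn (F : Set α)) 2) h).eRk ((gr (M.disjointSum (Matroid.truncate (Matroid.freeOn (F : Set α)) 2) h) \ I : Finset α) : Set α)).toNat + ((M.disjointSum (Matroid.truncate (Matroid.freeOn (F : Set α)) 2) h).eRk (I : Set α)).toNat then
          (((M.disjointSum (Matroid.truncate (Matroid.freeOn (F : Set α)) 2) h).eRk ((gr (M.disjointSum (Matroid.truncate (Matroid.freeOn (F : Set α)) 2) h) \ I : Finset α) : Set α)).toNat).choose δ else 0)) ≤
        ∑ I ∈ (gr (M.disjointSum (Matroid.truncate (Matroid.freeOn (F : Set α)) 2) h)).powerset, (if lo + δ ≤ ((M.disjointSum (Matroid.truncate (Matroid.freeOn (F : Set α)) 2) h).eRk ((gr (M.disjointSum (Matroid.truncate (Matroid.freeOn (F : Set α)) 2) h) \ I : Finset α) : Set α)).toNat ∧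
          ((M.disjointSum (Matroid.truncate (Matroid.freeOn (F : Set α)) 2) h).eRk ((gr (M.disjointSum (Matroid.truncate (Matroid.freeOn (F : Set α)) 2) h) \ I : Finset α) : Set α)).toNat ≤ hi + δ then
          (((M.disjointSum (Matroid.truncate (Matroid.freeOn (F : Set α)) 2) h).eRk ((gr (M.disjointSum (Matroid.truncate (Matroid.freeOn (F : Set α)) 2) h) \ I : Finset α) : Set α)).toNat).choose δ else 0) := by
  haveI := PLDTruncate.freeOn_finite' F
  haveI := PLDClosure.disjointSum_finite' _ _ h
  have hU : (Matroid.truncate (Matroid.freeOn (F : Set α)) 2).eRank ≤ ((2 : ℕ) : ℕ∞) := by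
    rw [Matroid.truncate_eRank]; exact min_le_right _ _
  have hr' : M.eRank ≤ ((11 : ℕ) : ℕ∞) := by exact_mod_cast hr
  have hb : ∀ I ∈ (gr (M.disjointSum (Matroid.truncate (Matroid.freeOn (F : Set α)) 2) h)).powerset,
      ((M.disjointSum (Matroid.truncate (Matroid.freeOn (F : Set α)) 2) h).eRk (I : Set α)).toNat ≤ 13 ∧ ((M.disjointSum (Matroid.truncate (Matroid.freeOn (F : Set α)) 2) h).eRk ((gr (M.disjointSum (Matroid.truncate (Matroid.freeOn (F : Set α)) 2) h) \ I : Finset α) : Set α)).toNat ≤ 13 := by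
    intro I _
    constructor
    · rw [PLDClosure.toNat_eRk_disjointSum]
      have h1 := PLDCert.toNat_eRk_le_of_eRank_le M hr' ((I ∩ gr M : Finset α) : Set α)
      have h2 := PLDCert.toNat_eRk_le_of_eRank_le _ hU ((I ∩ gr (Matroid.truncate (Matroid.freeOn (F : Set α)) 2) : Finset α) : Set α)
      omega
    · rw [PLDClosure.toNat_eRk_disjointSum]
      have h1 := PLDCert.toNat_eRk_le_of_eRank_le M hr' (((gr (M.disjointSum (Matroid.truncate (Matroid.freeOn (F : Set α)) 2) h) \ I) ∩ gr M : Finset α) : Set α)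
      have h2 := PLDCert.toNat_eRk_le_of_eRank_le _ hU (((gr (M.disjointSum (Matroid.truncate (Matroid.freeOn (F : Set α)) 2) h) \ I) ∩ gr (Matroid.truncate (Matroid.freeOn (F : Set α)) 2) : Finset α) : Set α)
      omega
  refine PLDSymCex.pld_of_bounded (gr (M.disjointSum (Matroid.truncate (Matroid.freeOn (F : Set α)) 2) h)).powerset (fun I : Finset α => ((M.disjointSum (Matroid.truncate (Matroid.freeOn (F : Set α)) 2) h).eRk (I : Set α)).toNat)
    (fun I : Finset α => ((M.disjointSum (Matroid.truncate (Matroid.freeOn (F : Set α)) 2) h).eRk ((gr (M.disjointSum (Matroid.truncate (Matroid.freeOn (F : Set α)) 2) h) \ I : Finset α) : Set α)).toNat) 13 hb ?_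
  intro lo hi δ hlh hhR hδR
  have hL := PLDClosure.sum_powerset_disjointSum M _ h
    (fun x f => if lo ≤ x ∧ x ≤ hi ∧ (if lo = 0 then 0 else lo + hi + δ) ≤ f + x then f.choose δ else 0)
  have hR := PLDClosure.sum_powerset_disjointSum M _ h
    (fun x f => if lo + δ ≤ f ∧ f ≤ hi + δ then f.choose δ else 0)
  beta_reduce at hL hR
  rw [hL, hR]
  have h2L : ∀ x₁ f₁ : ℕ,
      ∑ I₂ ∈ (gr (Matroid.truncate (Matroid.freeOn (F : Set α)) 2)).powerset,
        (if lo ≤ x₁ + ((Matroid.truncate (Matroid.freeOn (F : Set α)) 2).eRk (I₂ : Set α)).toNat ∧ x₁ + ((Matroid.truncate (Matroid.freeOn (F : Set α)) 2).eRk (I₂ : Set α)).toNat ≤ hi ∧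
            (if lo = 0 then 0 else lo + hi + δ) ≤ f₁ + ((Matroid.truncate (Matroid.freeOn (F : Set α)) 2).eRk ((gr (Matroid.truncate (Matroid.freeOn (F : Set α)) 2) \ I₂ : Finset α) : Set α)).toNat +
              (x₁ + ((Matroid.truncate (Matroid.freeOn (F : Set α)) 2).eRk (I₂ : Set α)).toNat) then
          (f₁ + ((Matroid.truncate (Matroid.freeOn (F : Set α)) 2).eRk ((gr (Matroid.truncate (Matroid.freeOn (F : Set α)) 2) \ I₂ : Finset α) : Set α)).toNat).choose δ else 0) =
      (∑ i ∈ range (F.card + 1), Nat.choose F.card i * (if lo ≤ x₁ + min i 2 ∧ x₁ + min i 2 ≤ hi ∧ (if lo = 0 then 0 else lo + hi + δ) ≤ (f₁ + min (F.card - i) 2) + (x₁ + min i 2) then (f₁ + min (F.card - i) 2).choose δ else 0)) := by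
    intro x₁ f₁
    have := PLDTruncate.sum_powerset_truncate_freeOn F 2
      (fun x₂ f₂ => if lo ≤ x₁ + x₂ ∧ x₁ + x₂ ≤ hi ∧ (if lo = 0 then 0 else lo + hi + δ) ≤ f₁ + f₂ + (x₁ + x₂) then
        (f₁ + f₂).choose δ else 0)
    beta_reduce at this
    exact this
  have h2R : ∀ f₁ : ℕ,
      ∑ I₂ ∈ (gr (Matroid.truncate (Matroid.freeOn (F : Set α)) 2)).powerset,
        (if lo + δ ≤ f₁ + ((Matroid.truncate (Matroid.freeOn (F : Set α)) 2).eRk ((gr (Matroid.truncate (Matroid.freeOn (F : Set α)) 2) \ I₂ : Finset α) : Set α)).toNat ∧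
            f₁ + ((Matroid.truncate (Matroid.freeOn (F : Set α)) 2).eRk ((gr (Matroid.truncate (Matroid.freeOn (F : Set α)) 2) \ I₂ : Finset α) : Set α)).toNat ≤ hi + δ then
          (f₁ + ((Matroid.truncate (Matroid.freeOn (F : Set α)) 2).eRk ((gr (Matroid.truncate (Matroid.freeOn (F : Set α)) 2) \ I₂ : Finset α) : Set α)).toNat).choose δ else 0) =
      (∑ i ∈ range (F.card + 1), Nat.choose F.card i * (if lo + δ ≤ f₁ + min (F.card - i) 2 ∧ f₁ + min (F.card - i) 2 ≤ hi + δ then (f₁ + min (F.card - i) 2).choose δ else 0)) := by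
    intro f₁
    have := PLDTruncate.sum_powerset_truncate_freeOn F 2
      (fun x₂ f₂ => if lo + δ ≤ f₁ + f₂ ∧ f₁ + f₂ ≤ hi + δ then (f₁ + f₂).choose δ else 0)
    beta_reduce at this
    exact this
  simp only [h2L, h2R]
  -- the case `m = 4` from the landed table, in 28 δ-parts
  have h4 : ∑ I ∈ (gr M).powerset, (∑ i ∈ range (4 + 1), Nat.choose 4 i * (if lo ≤ (M.eRk (I : Set α)).toNat + min i 2 ∧ (M.eRk (I : Set α)).toNat + min i 2 ≤ hi ∧ (if lo = 0 then 0 else lo + hi + δ) ≤ ((M.eRk ((gr M \ I : Finset α) : Set α)).toNat + min (4 - i) 2) + ((M.eRk (I : Set α)).toNat + min i 2) then ((M.eRk ((gr M \ I : Finset α) : Set α)).toNat + min (4 - i) 2).choose δ else 0)) ≤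
      ∑ I ∈ (gr M).powerset, (∑ i ∈ range (4 + 1), Nat.choose 4 i * (if lo + δ ≤ (M.eRk ((gr M \ I : Finset α) : Set α)).toNat + min (4 - i) 2 ∧ (M.eRk ((gr M \ I : Finset α) : Set α)).toNat + min (4 - i) 2 ≤ hi + δ then ((M.eRk ((gr M \ I : Finset α) : Set α)).toNat + min (4 - i) 2).choose δ else 0)) := by
    rcases Nat.lt_or_ge δ 0 with hδ0 | hδ0
    · obtain ⟨hDpos, hadm, hcert⟩ := PLDTriangle.uniform_2_4_table_11_part0 _ rfl lo (mem_range.2 (by omega)) hi (mem_range.2 (by omega))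
        δ (mem_range.2 (by omega)) hlh
      have key := PLDCert.sum_le_of_cert M hPLD 11 hr' _ hadm _ _ hcert
      rw [← Finset.mul_sum, ← Finset.mul_sum] at key
      exact Nat.le_of_mul_le_mul_left key hDpos
    rcases Nat.lt_or_ge δ 1 with hδ1 | hδ1
    · obtain ⟨hDpos, hadm, hcert⟩ := PLDTriangle.uniform_2_4_table_11_part1 _ rfl lo (mem_range.2 (by omega)) hi (mem_range.2 (by omega))
        δ (mem_range.2 (by omega)) hlh
      have key := PLDCert.sum_le_of_cert M hPLD 11 hr' _ hadm _ _ hcert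
      rw [← Finset.mul_sum, ← Finset.mul_sum] at key
      exact Nat.le_of_mul_le_mul_left key hDpos
    rcases Nat.lt_or_ge δ 2 with hδ2 | hδ2
    · obtain ⟨hDpos, hadm, hcert⟩ := PLDTriangle.uniform_2_4_table_11_part2 _ rfl lo (mem_range.2 (by omega)) hi (mem_range.2 (by omega))
        δ (mem_Ico.2 ⟨by omega, by omega⟩) hlh
      have key := PLDCert.sum_le_of_cert M hPLD 11 hr' _ hadm _ _ hcert
      rw [← Finset.mul_sum, ← Finset.mul_sum] at key
      exact Nat.le_of_mul_le_mul_left key hDpos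
    rcases Nat.lt_or_ge δ 2 with hδ3 | hδ3
    · obtain ⟨hDpos, hadm, hcert⟩ := PLDTriangle.uniform_2_4_table_11_part3 _ rfl lo (mem_range.2 (by omega)) hi (mem_range.2 (by omega))
        δ (mem_Ico.2 ⟨by omega, by omega⟩) hlh
      have key := PLDCert.sum_le_of_cert M hPLD 11 hr' _ hadm _ _ hcert
      rw [← Finset.mul_sum, ← Finset.mul_sum] at key
      exact Nat.le_of_mul_le_mul_left key hDpos
    rcases Nat.lt_or_ge δ 2 with hδ4 | hδ4
    · obtain ⟨hDpos, hadm, hcert⟩ := PLDTriangle.uniform_2_4_table_11_part4 _ rfl lo (mem_range.2 (by omega)) hi (mem_range.2 (by omega))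
        δ (mem_Ico.2 ⟨by omega, by omega⟩) hlh
      have key := PLDCert.sum_le_of_cert M hPLD 11 hr' _ hadm _ _ hcert
      rw [← Finset.mul_sum, ← Finset.mul_sum] at key
      exact Nat.le_of_mul_le_mul_left key hDpos
    rcases Nat.lt_or_ge δ 3 with hδ5 | hδ5
    · obtain ⟨hDpos, hadm, hcert⟩ := PLDTriangle.uniform_2_4_table_11_part5 _ rfl lo (mem_range.2 (by omega)) hi (mem_range.2 (by omega))
        δ (mem_Ico.2 ⟨by omega, by omega⟩) hlh
      have key := PLDCert.sum_le_of_cert M hPLD 11 hr' _ hadm _ _ hcert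
      rw [← Finset.mul_sum, ← Finset.mul_sum] at key
      exact Nat.le_of_mul_le_mul_left key hDpos
    rcases Nat.lt_or_ge δ 4 with hδ6 | hδ6
    · obtain ⟨hDpos, hadm, hcert⟩ := PLDTriangle.uniform_2_4_table_11_part6 _ rfl lo (mem_range.2 (by omega)) hi (mem_range.2 (by omega))
        δ (mem_Ico.2 ⟨by omega, by omega⟩) hlh
      have key := PLDCert.sum_le_of_cert M hPLD 11 hr' _ hadm _ _ hcert
      rw [← Finset.mul_sum, ← Finset.mul_sum] at key
      exact Nat.le_of_mul_le_mul_left key hDpos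
    rcases Nat.lt_or_ge δ 4 with hδ7 | hδ7
    · obtain ⟨hDpos, hadm, hcert⟩ := PLDTriangle.uniform_2_4_table_11_part7 _ rfl lo (mem_range.2 (by omega)) hi (mem_range.2 (by omega))
        δ (mem_Ico.2 ⟨by omega, by omega⟩) hlh
      have key := PLDCert.sum_le_of_cert M hPLD 11 hr' _ hadm _ _ hcert
      rw [← Finset.mul_sum, ← Finset.mul_sum] at key
      exact Nat.le_of_mul_le_mul_left key hDpos
    rcases Nat.lt_or_ge δ 4 with hδ8 | hδ8
    · obtain ⟨hDpos, hadm, hcert⟩ := PLDTriangle.uniform_2_4_table_11_part8 _ rfl lo (mem_range.2 (by omega)) hi (mem_range.2 (by omega))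
        δ (mem_Ico.2 ⟨by omega, by omega⟩) hlh
      have key := PLDCert.sum_le_of_cert M hPLD 11 hr' _ hadm _ _ hcert
      rw [← Finset.mul_sum, ← Finset.mul_sum] at key
      exact Nat.le_of_mul_le_mul_left key hDpos
    rcases Nat.lt_or_ge δ 5 with hδ9 | hδ9
    · obtain ⟨hDpos, hadm, hcert⟩ := PLDTriangle.uniform_2_4_table_11_part9 _ rfl lo (mem_range.2 (by omega)) hi (mem_range.2 (by omega))
        δ (mem_Ico.2 ⟨by omega, by omega⟩) hlh
      have key := PLDCert.sum_le_of_cert M hPLD 11 hr' _ hadm _ _ hcert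
      rw [← Finset.mul_sum, ← Finset.mul_sum] at key
      exact Nat.le_of_mul_le_mul_left key hDpos
    rcases Nat.lt_or_ge δ 6 with hδ10 | hδ10
    · obtain ⟨hDpos, hadm, hcert⟩ := PLDTriangle.uniform_2_4_table_11_part10 _ rfl lo (mem_range.2 (by omega)) hi (mem_range.2 (by omega))
        δ (mem_Ico.2 ⟨by omega, by omega⟩) hlh
      have key := PLDCert.sum_le_of_cert M hPLD 11 hr' _ hadm _ _ hcert
      rw [← Finset.mul_sum, ← Finset.mul_sum] at key
      exact Nat.le_of_mul_le_mul_left key hDpos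
    rcases Nat.lt_or_ge δ 6 with hδ11 | hδ11
    · obtain ⟨hDpos, hadm, hcert⟩ := PLDTriangle.uniform_2_4_table_11_part11 _ rfl lo (mem_range.2 (by omega)) hi (mem_range.2 (by omega))
        δ (mem_Ico.2 ⟨by omega, by omega⟩) hlh
      have key := PLDCert.sum_le_of_cert M hPLD 11 hr' _ hadm _ _ hcert
      rw [← Finset.mul_sum, ← Finset.mul_sum] at key
      exact Nat.le_of_mul_le_mul_left key hDpos
    rcases Nat.lt_or_ge δ 6 with hδ12 | hδ12
    · obtain ⟨hDpos, hadm, hcert⟩ := PLDTriangle.uniform_2_4_table_11_part12 _ rfl lo (mem_range.2 (by omega)) hi (mem_range.2 (by omega))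
        δ (mem_Ico.2 ⟨by omega, by omega⟩) hlh
      have key := PLDCert.sum_le_of_cert M hPLD 11 hr' _ hadm _ _ hcert
      rw [← Finset.mul_sum, ← Finset.mul_sum] at key
      exact Nat.le_of_mul_le_mul_left key hDpos
    rcases Nat.lt_or_ge δ 7 with hδ13 | hδ13
    · obtain ⟨hDpos, hadm, hcert⟩ := PLDTriangle.uniform_2_4_table_11_part13 _ rfl lo (mem_range.2 (by omega)) hi (mem_range.2 (by omega))
        δ (mem_Ico.2 ⟨by omega, by omega⟩) hlh
      have key := PLDCert.sum_le_of_cert M hPLD 11 hr' _ hadm _ _ hcert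
      rw [← Finset.mul_sum, ← Finset.mul_sum] at key
      exact Nat.le_of_mul_le_mul_left key hDpos
    rcases Nat.lt_or_ge δ 8 with hδ14 | hδ14
    · obtain ⟨hDpos, hadm, hcert⟩ := PLDTriangle.uniform_2_4_table_11_part14 _ rfl lo (mem_range.2 (by omega)) hi (mem_range.2 (by omega))
        δ (mem_Ico.2 ⟨by omega, by omega⟩) hlh
      have key := PLDCert.sum_le_of_cert M hPLD 11 hr' _ hadm _ _ hcert
      rw [← Finset.mul_sum, ← Finset.mul_sum] at key
      exact Nat.le_of_mul_le_mul_left key hDpos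
    rcases Nat.lt_or_ge δ 8 with hδ15 | hδ15
    · obtain ⟨hDpos, hadm, hcert⟩ := PLDTriangle.uniform_2_4_table_11_part15 _ rfl lo (mem_range.2 (by omega)) hi (mem_range.2 (by omega))
        δ (mem_Ico.2 ⟨by omega, by omega⟩) hlh
      have key := PLDCert.sum_le_of_cert M hPLD 11 hr' _ hadm _ _ hcert
      rw [← Finset.mul_sum, ← Finset.mul_sum] at key
      exact Nat.le_of_mul_le_mul_left key hDpos
    rcases Nat.lt_or_ge δ 8 with hδ16 | hδ16
    · obtain ⟨hDpos, hadm, hcert⟩ := PLDTriangle.uniform_2_4_table_11_part16 _ rfl lo (mem_range.2 (by omega)) hi (mem_range.2 (by omega))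
        δ (mem_Ico.2 ⟨by omega, by omega⟩) hlh
      have key := PLDCert.sum_le_of_cert M hPLD 11 hr' _ hadm _ _ hcert
      rw [← Finset.mul_sum, ← Finset.mul_sum] at key
      exact Nat.le_of_mul_le_mul_left key hDpos
    rcases Nat.lt_or_ge δ 9 with hδ17 | hδ17
    · obtain ⟨hDpos, hadm, hcert⟩ := PLDTriangle.uniform_2_4_table_11_part17 _ rfl lo (mem_range.2 (by omega)) hi (mem_range.2 (by omega))
        δ (mem_Ico.2 ⟨by omega, by omega⟩) hlh
      have key := PLDCert.sum_le_of_cert M hPLD 11 hr' _ hadm _ _ hcert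
      rw [← Finset.mul_sum, ← Finset.mul_sum] at key
      exact Nat.le_of_mul_le_mul_left key hDpos
    rcases Nat.lt_or_ge δ 10 with hδ18 | hδ18
    · obtain ⟨hDpos, hadm, hcert⟩ := PLDTriangle.uniform_2_4_table_11_part18 _ rfl lo (mem_range.2 (by omega)) hi (mem_range.2 (by omega))
        δ (mem_Ico.2 ⟨by omega, by omega⟩) hlh
      have key := PLDCert.sum_le_of_cert M hPLD 11 hr' _ hadm _ _ hcert
      rw [← Finset.mul_sum, ← Finset.mul_sum] at key
      exact Nat.le_of_mul_le_mul_left key hDpos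
    rcases Nat.lt_or_ge δ 10 with hδ19 | hδ19
    · obtain ⟨hDpos, hadm, hcert⟩ := PLDTriangle.uniform_2_4_table_11_part19 _ rfl lo (mem_range.2 (by omega)) hi (mem_range.2 (by omega))
        δ (mem_Ico.2 ⟨by omega, by omega⟩) hlh
      have key := PLDCert.sum_le_of_cert M hPLD 11 hr' _ hadm _ _ hcert
      rw [← Finset.mul_sum, ← Finset.mul_sum] at key
      exact Nat.le_of_mul_le_mul_left key hDpos
    rcases Nat.lt_or_ge δ 10 with hδ20 | hδ20
    · obtain ⟨hDpos, hadm, hcert⟩ := PLDTriangle.uniform_2_4_table_11_part20 _ rfl lo (mem_range.2 (by omega)) hi (mem_range.2 (by omega))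
        δ (mem_Ico.2 ⟨by omega, by omega⟩) hlh
      have key := PLDCert.sum_le_of_cert M hPLD 11 hr' _ hadm _ _ hcert
      rw [← Finset.mul_sum, ← Finset.mul_sum] at key
      exact Nat.le_of_mul_le_mul_left key hDpos
    rcases Nat.lt_or_ge δ 11 with hδ21 | hδ21
    · obtain ⟨hDpos, hadm, hcert⟩ := PLDTriangle.uniform_2_4_table_11_part21 _ rfl lo (mem_range.2 (by omega)) hi (mem_range.2 (by omega))
        δ (mem_Ico.2 ⟨by omega, by omega⟩) hlh
      have key := PLDCert.sum_le_of_cert M hPLD 11 hr' _ hadm _ _ hcert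
      rw [← Finset.mul_sum, ← Finset.mul_sum] at key
      exact Nat.le_of_mul_le_mul_left key hDpos
    rcases Nat.lt_or_ge δ 12 with hδ22 | hδ22
    · obtain ⟨hDpos, hadm, hcert⟩ := PLDTriangle.uniform_2_4_table_11_part22 _ rfl lo (mem_range.2 (by omega)) hi (mem_range.2 (by omega))
        δ (mem_Ico.2 ⟨by omega, by omega⟩) hlh
      have key := PLDCert.sum_le_of_cert M hPLD 11 hr' _ hadm _ _ hcert
      rw [← Finset.mul_sum, ← Finset.mul_sum] at key
      exact Nat.le_of_mul_le_mul_left key hDpos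
    rcases Nat.lt_or_ge δ 12 with hδ23 | hδ23
    · obtain ⟨hDpos, hadm, hcert⟩ := PLDTriangle.uniform_2_4_table_11_part23 _ rfl lo (mem_range.2 (by omega)) hi (mem_range.2 (by omega))
        δ (mem_Ico.2 ⟨by omega, by omega⟩) hlh
      have key := PLDCert.sum_le_of_cert M hPLD 11 hr' _ hadm _ _ hcert
      rw [← Finset.mul_sum, ← Finset.mul_sum] at key
      exact Nat.le_of_mul_le_mul_left key hDpos
    rcases Nat.lt_or_ge δ 12 with hδ24 | hδ24
    · obtain ⟨hDpos, hadm, hcert⟩ := PLDTriangle.uniform_2_4_table_11_part24 _ rfl lo (mem_range.2 (by omega)) hi (mem_range.2 (by omega))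
        δ (mem_Ico.2 ⟨by omega, by omega⟩) hlh
      have key := PLDCert.sum_le_of_cert M hPLD 11 hr' _ hadm _ _ hcert
      rw [← Finset.mul_sum, ← Finset.mul_sum] at key
      exact Nat.le_of_mul_le_mul_left key hDpos
    rcases Nat.lt_or_ge δ 13 with hδ25 | hδ25
    · obtain ⟨hDpos, hadm, hcert⟩ := PLDTriangle.uniform_2_4_table_11_part25 _ rfl lo (mem_range.2 (by omega)) hi (mem_range.2 (by omega))
        δ (mem_Ico.2 ⟨by omega, by omega⟩) hlh
      have key := PLDCert.sum_le_of_cert M hPLD 11 hr' _ hadm _ _ hcert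
      rw [← Finset.mul_sum, ← Finset.mul_sum] at key
      exact Nat.le_of_mul_le_mul_left key hDpos
    rcases Nat.lt_or_ge δ 14 with hδ26 | hδ26
    · obtain ⟨hDpos, hadm, hcert⟩ := PLDTriangle.uniform_2_4_table_11_part26 _ rfl lo (mem_range.2 (by omega)) hi (mem_range.2 (by omega))
        δ (mem_Ico.2 ⟨by omega, by omega⟩) hlh
      have key := PLDCert.sum_le_of_cert M hPLD 11 hr' _ hadm _ _ hcert
      rw [← Finset.mul_sum, ← Finset.mul_sum] at key
      exact Nat.le_of_mul_le_mul_left key hDpos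
    obtain ⟨hDpos, hadm, hcert⟩ := PLDTriangle.uniform_2_4_table_11_part27 _ rfl lo (mem_range.2 (by omega)) hi (mem_range.2 (by omega))
      δ (mem_Ico.2 ⟨by omega, by omega⟩) hlh
    have key := PLDCert.sum_le_of_cert M hPLD 11 hr' _ hadm _ _ hcert
    rw [← Finset.mul_sum, ← Finset.mul_sum] at key
    exact Nat.le_of_mul_le_mul_left key hDpos
  -- the lift to `m = |F| ≥ 4`
  exact lift_instance (gr M).powerset (fun I : Finset α => (M.eRk (I : Set α)).toNat)
    (fun I : Finset α => (M.eRk ((gr M \ I : Finset α) : Set α)).toNat) hPLD 4 F.card (by omega) hF lo hi δ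
    (if lo = 0 then 0 else lo + hi + δ) (by split_ifs <;> omega) (by split_ifs <;> omega) h4

end PLDTwoLiftGen

end PercRepro
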